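import Mathlib.Analysis.SpecialFunctions.Trigonometric.Bounds
import HarnessLib

/-!
# Route `UnitScaleTilt`, crux K1 «MinimiserStabilityRegPr» (stmt-QuantumFields-19200), route-R E′ path (α′) — the sup-row residue (hK), row (W1) for the assembly (A), part 1 of 2:
# THE CHORDAL PROFILE `s(τ) = (N∕π)|sin(πτ∕N)|` AND THE SMOOTHED LENGTH `√(B + s²)` — Lipschitz and second-difference letters

Cell `ym3-torus`, D-0154 (3c) twin-width seat `ym-routeR-w2` (gen 5).  THEOREMS ONLY (0 `def`, 0 `sorry`); `--supports stmt-QuantumFields-19200 --as helper`,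
count-neutral.  YM₃ on T³ is a ladder rung (R3), not the Clay problem; nothing here claims the stub, the crux, d = 4 or the gap.

THE POINT.  The Agmon bound (D2′) ✓ `Prop7PinnedBiharmonicAgmonDecay.weighted_laplace_le(_core)` (ym-routeR-w6 g5) DISPLAYS its weight `ω` through two smoothness rows
`|ω(x±e_μ) − ω x| ≤ a·ω x`, `|ω(x+e_μ) + ω(x−e_μ) − 2ω x| ≤ b·ω x` and its window wants `a ≍ κ∕ℓ`, `b ≍ κ∕ℓ²`.  The raw torus distance has an O(1) concave kink at the
antipode (and `|t|` one at the base point), which breaks the `ℓ⁻²` row; part 2 (`…TorusAgmonWeight`) builds `ω = exp(κ f∕ℓ)` from the SMOOTH periodic chordal profile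
`f(x) = √(ℓ² + Σ_μ s_μ(x)²)`, `s_μ = (N∕π)|sin(π t_μ∕N)|`.  This part supplies the one-variable letters: `√(B+s²)` is 1-Lipschitz in `s` and has second differences `≤ 2∕√B`
when `s` moves by `≤ 1` with `|δ²(s²)| ≤ 2`; the chordal profile is `N`-periodic, 1-Lipschitz on the integers, has `|δ²(s²)| ≤ 2`, and is pinched `(2∕π)·min(τ,N−τ) ≤ s(τ) ≤ min(τ,N−τ)`.

WHAT IS PROVED (ns `…Theorems.Prop7TorusAgmonWeight`; pure real analysis).
* §1 `le_sqrt_add_sq`, `sqrt_le_sqrt_add_sq`, `sqrt_add_sq_sub_eq`, ★ `abs_sqrt_add_sq_sub_le` (`|√(B+u²) − √(B+v²)| ≤ 1` for `|u−v| ≤ 1`),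
  ★★ `abs_sqrt_add_sq_second_diff_le` (`|√(B+s₊²) + √(B+s₋²) − 2√(B+s₀²)| ≤ 2∕√B`, by the identity `δ²f = δ²S∕D₊ + (S₀−S₋)(f₋−f₊)∕(D₊D₋)`, `D_± ≥ 2√B`).
* §2 `chord_periodic`, ★ `abs_chord_succ_sub_le`, ★ `abs_chord_sq_second_diff_le` (`cos(a+h)+cos(a−h) = 2cos a cos h`, `1 − cos h ≤ h²∕2`), ★ `chord_compare` (Jordan `(2∕π)θ ≤ sin θ`
  on `[0,π∕2]` = ✓ `Real.mul_le_sin`, and `sin θ ≤ θ`).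
HONEST SCOPE.  Folklore calculus; no lattice object appears here.

References: T. Bałaban, CMP 96 (1984) 223–250 [Balaban1984PropagatorsII] ((1.9) p.226 — the weighted `L²` method).
-/

set_option autoImplicit false

noncomputable section

open scoped BigOperators

namespace Summit.QuantumFields.YangMills.Theorems.Prop7TorusAgmonWeight

open Finset

/-! ## §1 Algebra of `f(s) = √(B + s²)`: first and second differences -/

/-- `s ≤ √(B + s²)` for `B ≥ 0`, `s ≥ 0`. [folklore] -/
theorem le_sqrt_add_sq {B s : ℝ} (hB : 0 ≤ B) (hs : 0 ≤ s) : s ≤ Real.sqrt (B + s ^ 2) := by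
  calc s = Real.sqrt (s ^ 2) := (Real.sqrt_sq hs).symm
    _ ≤ Real.sqrt (B + s ^ 2) := Real.sqrt_le_sqrt (by linarith)

/-- `√B ≤ √(B + s²)`. [folklore] -/
theorem sqrt_le_sqrt_add_sq (B s : ℝ) : Real.sqrt B ≤ Real.sqrt (B + s ^ 2) := Real.sqrt_le_sqrt (by nlinarith)

/-- the difference formula `√(B+u²) − √(B+v²) = (u² − v²)∕(√(B+u²) + √(B+v²))` (`B > 0`). [folklore] -/
theorem sqrt_add_sq_sub_eq {B : ℝ} (hB : 0 < B) (u v : ℝ) :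
    Real.sqrt (B + u ^ 2) - Real.sqrt (B + v ^ 2) = (u ^ 2 - v ^ 2) / (Real.sqrt (B + u ^ 2) + Real.sqrt (B + v ^ 2)) := by
  have h1 : 0 < Real.sqrt (B + u ^ 2) := Real.sqrt_pos.mpr (by positivity)
  have h2 : 0 < Real.sqrt (B + v ^ 2) := Real.sqrt_pos.mpr (by positivity)
  have hD : Real.sqrt (B + u ^ 2) + Real.sqrt (B + v ^ 2) ≠ 0 := by linarith
  rw [eq_div_iff hD]
  have e1 : Real.sqrt (B + u ^ 2) ^ 2 = B + u ^ 2 := Real.sq_sqrt (by positivity)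
  have e2 : Real.sqrt (B + v ^ 2) ^ 2 = B + v ^ 2 := Real.sq_sqrt (by positivity)
  nlinarith [e1, e2]

/-- **FIRST DIFFERENCE**: for `u, v ≥ 0` with `|u − v| ≤ 1`: `|√(B+u²) − √(B+v²)| ≤ 1` (`B > 0`). [folklore] -/
theorem abs_sqrt_add_sq_sub_le {B : ℝ} (hB : 0 < B) {u v : ℝ} (hu : 0 ≤ u) (hv : 0 ≤ v) (huv : |u - v| ≤ 1) :
    |Real.sqrt (B + u ^ 2) - Real.sqrt (B + v ^ 2)| ≤ 1 := by
  have h1 : 0 < Real.sqrt (B + u ^ 2) := Real.sqrt_pos.mpr (by positivity)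
  have h2 : 0 < Real.sqrt (B + v ^ 2) := Real.sqrt_pos.mpr (by positivity)
  have hu' := le_sqrt_add_sq hB.le hu
  have hv' := le_sqrt_add_sq hB.le hv
  rw [sqrt_add_sq_sub_eq hB, abs_div, abs_of_pos (by linarith : 0 < Real.sqrt (B + u ^ 2) + Real.sqrt (B + v ^ 2)),
    div_le_one (by linarith)]
  have e : u ^ 2 - v ^ 2 = (u - v) * (u + v) := by ring
  rw [e, abs_mul, abs_of_nonneg (by linarith : 0 ≤ u + v)]
  calc |u - v| * (u + v) ≤ 1 * (u + v) := mul_le_mul_of_nonneg_right huv (by linarith)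
    _ ≤ Real.sqrt (B + u ^ 2) + Real.sqrt (B + v ^ 2) := by linarith

/-- **SECOND DIFFERENCE**: for `s₊, s₀, s₋ ≥ 0` with `|s₊ − s₀| ≤ 1`, `|s₋ − s₀| ≤ 1` and `|s₊² + s₋² − 2s₀²| ≤ 2`:
`|√(B+s₊²) + √(B+s₋²) − 2√(B+s₀²)| ≤ 2∕√B` (`B > 0`) — the identity `δ²f = δ²S∕D₊ + (S₀−S₋)(f₋−f₊)∕(D₊D₋)`, `D_± = f_± + f₀ ≥ 2√B`. [folklore] -/
theorem abs_sqrt_add_sq_second_diff_le {B : ℝ} (hB : 0 < B) {sp s0 sm : ℝ} (hp : 0 ≤ sp) (h0 : 0 ≤ s0) (hm : 0 ≤ sm)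
    (hp1 : |sp - s0| ≤ 1) (hm1 : |sm - s0| ≤ 1) (h2 : |sp ^ 2 + sm ^ 2 - 2 * s0 ^ 2| ≤ 2) :
    |Real.sqrt (B + sp ^ 2) + Real.sqrt (B + sm ^ 2) - 2 * Real.sqrt (B + s0 ^ 2)| ≤ 2 / Real.sqrt B := by
  set fp := Real.sqrt (B + sp ^ 2) with hfp
  set f0 := Real.sqrt (B + s0 ^ 2) with hf0
  set fm := Real.sqrt (B + sm ^ 2) with hfm
  have hrB : 0 < Real.sqrt B := Real.sqrt_pos.mpr hB
  have hfpB : Real.sqrt B ≤ fp := sqrt_le_sqrt_add_sq B sp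
  have hf0B : Real.sqrt B ≤ f0 := sqrt_le_sqrt_add_sq B s0
  have hfmB : Real.sqrt B ≤ fm := sqrt_le_sqrt_add_sq B sm
  have hsp : sp ≤ fp := le_sqrt_add_sq hB.le hp
  have hs0 : s0 ≤ f0 := le_sqrt_add_sq hB.le h0
  have hsm : sm ≤ fm := le_sqrt_add_sq hB.le hm
  -- the two first differences
  have dP : fp - f0 = (sp ^ 2 - s0 ^ 2) / (fp + f0) := sqrt_add_sq_sub_eq hB sp s0
  have dM : f0 - fm = (s0 ^ 2 - sm ^ 2) / (f0 + fm) := sqrt_add_sq_sub_eq hB s0 sm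
  have hDp : 0 < fp + f0 := by linarith
  have hDm : 0 < f0 + fm := by linarith
  -- |f₋ − f₊| ≤ 2
  have h1p : |fp - f0| ≤ 1 := abs_sqrt_add_sq_sub_le hB hp h0 hp1
  have h1m : |fm - f0| ≤ 1 := abs_sqrt_add_sq_sub_le hB hm h0 hm1
  have hfmfp : |fm - fp| ≤ 2 := by
    have e : fm - fp = (fm - f0) - (fp - f0) := by ring
    rw [e]; exact (abs_sub _ _).trans (by linarith)
  -- |S₀ − S₋| ≤ f₀ + f₋
  have hA' : |s0 ^ 2 - sm ^ 2| ≤ f0 + fm := by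
    have e : s0 ^ 2 - sm ^ 2 = (s0 - sm) * (s0 + sm) := by ring
    rw [e, abs_mul, abs_of_nonneg (by linarith : 0 ≤ s0 + sm)]
    have : |s0 - sm| ≤ 1 := by rw [abs_sub_comm]; exact hm1
    calc |s0 - sm| * (s0 + sm) ≤ 1 * (s0 + sm) := mul_le_mul_of_nonneg_right this (by linarith)
      _ ≤ f0 + fm := by linarith
  -- the identity
  have key : fp + fm - 2 * f0 = (sp ^ 2 + sm ^ 2 - 2 * s0 ^ 2) / (fp + f0) + (s0 ^ 2 - sm ^ 2) * (fm - fp) / ((fp + f0) * (f0 + fm)) := by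
    have e : fp + fm - 2 * f0 = (fp - f0) - (f0 - fm) := by ring
    rw [e, dP, dM]
    field_simp
    ring
  rw [key]
  have t1 : |(sp ^ 2 + sm ^ 2 - 2 * s0 ^ 2) / (fp + f0)| ≤ 1 / Real.sqrt B := by
    rw [abs_div, abs_of_pos hDp, div_le_div_iff₀ hDp hrB]
    calc |sp ^ 2 + sm ^ 2 - 2 * s0 ^ 2| * Real.sqrt B ≤ 2 * Real.sqrt B := mul_le_mul_of_nonneg_right h2 hrB.le
      _ ≤ 1 * (fp + f0) := by linarith
  have t2 : |(s0 ^ 2 - sm ^ 2) * (fm - fp) / ((fp + f0) * (f0 + fm))| ≤ 1 / Real.sqrt B := by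
    rw [abs_div, abs_mul, abs_of_pos (mul_pos hDp hDm), div_le_div_iff₀ (mul_pos hDp hDm) hrB]
    calc |s0 ^ 2 - sm ^ 2| * |fm - fp| * Real.sqrt B ≤ (f0 + fm) * 2 * Real.sqrt B := by
          apply mul_le_mul_of_nonneg_right _ hrB.le
          exact mul_le_mul hA' hfmfp (abs_nonneg _) (by linarith)
      _ ≤ 1 * ((fp + f0) * (f0 + fm)) := by nlinarith
  calc |(sp ^ 2 + sm ^ 2 - 2 * s0 ^ 2) / (fp + f0) + (s0 ^ 2 - sm ^ 2) * (fm - fp) / ((fp + f0) * (f0 + fm))|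
      ≤ |(sp ^ 2 + sm ^ 2 - 2 * s0 ^ 2) / (fp + f0)| + |(s0 ^ 2 - sm ^ 2) * (fm - fp) / ((fp + f0) * (f0 + fm))| := abs_add_le _ _
    _ ≤ 1 / Real.sqrt B + 1 / Real.sqrt B := add_le_add t1 t2
    _ = 2 / Real.sqrt B := by ring

/-! ## §2 The chordal coordinate `s(τ) = (N∕π)|sin(πτ∕N)|`: periodicity, Lipschitz, second difference, comparison with the distance -/

/-- periodicity: `s(τ + N·q) = s(τ)` for integers `q`. [folklore] -/
theorem chord_periodic {N : ℝ} (hN : 0 < N) (τ : ℝ) (q : ℤ) :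
    N / Real.pi * |Real.sin (Real.pi * (τ + N * q) / N)| = N / Real.pi * |Real.sin (Real.pi * τ / N)| := by
  congr 1
  have e : Real.pi * (τ + N * q) / N = Real.pi * τ / N + q * Real.pi := by field_simp
  rw [e, Real.sin_add_int_mul_pi, abs_mul, abs_zpow, abs_neg, abs_one, one_zpow, one_mul]

/-- Lipschitz: `|s(τ+1) − s(τ)| ≤ 1`. [folklore] -/
theorem abs_chord_succ_sub_le {N : ℝ} (hN : 0 < N) (τ : ℝ) :
    abs (N / Real.pi * |Real.sin (Real.pi * (τ + 1) / N)| - N / Real.pi * |Real.sin (Real.pi * τ / N)|) ≤ 1 := by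
  have hπ := Real.pi_pos
  have hNπ : 0 < N / Real.pi := div_pos hN hπ
  rw [← mul_sub, abs_mul, abs_of_pos hNπ]
  have h1 := abs_abs_sub_abs_le (Real.sin (Real.pi * (τ + 1) / N)) (Real.sin (Real.pi * τ / N))
  have h2 := Real.abs_sin_sub_sin_le (Real.pi * (τ + 1) / N) (Real.pi * τ / N)
  have e : Real.pi * (τ + 1) / N - Real.pi * τ / N = Real.pi / N := by field_simp; ring
  rw [e, abs_of_pos (div_pos hπ hN)] at h2
  calc N / Real.pi * abs (|Real.sin (Real.pi * (τ + 1) / N)| - |Real.sin (Real.pi * τ / N)|)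
      ≤ N / Real.pi * (Real.pi / N) := mul_le_mul_of_nonneg_left (h1.trans h2) hNπ.le
    _ = 1 := by field_simp

/-- second difference of the SQUARE: `|s(τ+1)² + s(τ−1)² − 2s(τ)²| ≤ 2` (`s² = (N∕π)²(1 − cos(2πτ∕N))∕2`, `cos(a+h) + cos(a−h) = 2cos a·cos h`, `1 − cos h ≤ h²∕2`). [folklore] -/
theorem abs_chord_sq_second_diff_le {N : ℝ} (hN : 0 < N) (τ : ℝ) :
    |(N / Real.pi * |Real.sin (Real.pi * (τ + 1) / N)|) ^ 2 + (N / Real.pi * |Real.sin (Real.pi * (τ - 1) / N)|) ^ 2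
      - 2 * (N / Real.pi * |Real.sin (Real.pi * τ / N)|) ^ 2| ≤ 2 := by
  have hπ := Real.pi_pos
  simp only [mul_pow, sq_abs]
  have hs : ∀ θ : ℝ, Real.sin θ ^ 2 = (1 - Real.cos (2 * θ)) / 2 := fun θ => by
    rw [Real.cos_two_mul, Real.cos_sq']; ring
  rw [hs, hs, hs]
  have e1 : 2 * (Real.pi * (τ + 1) / N) = 2 * Real.pi * τ / N + 2 * Real.pi / N := by ring
  have e2 : 2 * (Real.pi * (τ - 1) / N) = 2 * Real.pi * τ / N - 2 * Real.pi / N := by ring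
  have e3 : 2 * (Real.pi * τ / N) = 2 * Real.pi * τ / N := by ring
  rw [e1, e2, e3, Real.cos_add, Real.cos_sub]
  have key : (N / Real.pi) ^ 2 * ((1 - (Real.cos (2 * Real.pi * τ / N) * Real.cos (2 * Real.pi / N)
      - Real.sin (2 * Real.pi * τ / N) * Real.sin (2 * Real.pi / N))) / 2)
      + (N / Real.pi) ^ 2 * ((1 - (Real.cos (2 * Real.pi * τ / N) * Real.cos (2 * Real.pi / N)
      + Real.sin (2 * Real.pi * τ / N) * Real.sin (2 * Real.pi / N))) / 2)
      - 2 * ((N / Real.pi) ^ 2 * ((1 - Real.cos (2 * Real.pi * τ / N)) / 2))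
      = (N / Real.pi) ^ 2 * (Real.cos (2 * Real.pi * τ / N) * (1 - Real.cos (2 * Real.pi / N))) := by ring
  rw [key, abs_mul, abs_of_nonneg (by positivity : (0:ℝ) ≤ (N / Real.pi) ^ 2), abs_mul]
  have hc1 : |Real.cos (2 * Real.pi * τ / N)| ≤ 1 := Real.abs_cos_le_one _
  have hc2 : 0 ≤ 1 - Real.cos (2 * Real.pi / N) := by linarith [Real.cos_le_one (2 * Real.pi / N)]
  have hc3 : 1 - Real.cos (2 * Real.pi / N) ≤ (2 * Real.pi / N) ^ 2 / 2 := by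
    have := Real.one_sub_sq_div_two_le_cos (x := 2 * Real.pi / N); linarith
  rw [abs_of_nonneg hc2]
  calc (N / Real.pi) ^ 2 * (|Real.cos (2 * Real.pi * τ / N)| * (1 - Real.cos (2 * Real.pi / N)))
      ≤ (N / Real.pi) ^ 2 * (1 * ((2 * Real.pi / N) ^ 2 / 2)) := by
        apply mul_le_mul_of_nonneg_left _ (by positivity)
        exact mul_le_mul hc1 hc3 hc2 zero_le_one
    _ = 2 := by field_simp

/-- comparison with the distance: for `0 ≤ τ ≤ N`, `(2∕π)·min(τ, N−τ) ≤ s(τ) ≤ min(τ, N−τ)`. [folklore] -/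
theorem chord_compare {N : ℝ} (hN : 0 < N) {τ : ℝ} (h0 : 0 ≤ τ) (h1 : τ ≤ N) :
    2 / Real.pi * min τ (N - τ) ≤ N / Real.pi * |Real.sin (Real.pi * τ / N)| ∧ N / Real.pi * |Real.sin (Real.pi * τ / N)| ≤ min τ (N - τ) := by
  have hπ := Real.pi_pos
  have hNπ : 0 < N / Real.pi := div_pos hN hπ
  -- reduce to `θ = πτ∕N ∈ [0, π]` and its reflection `π − θ`
  have hθ0 : 0 ≤ Real.pi * τ / N := by positivity
  have hθπ : Real.pi * τ / N ≤ Real.pi := by rw [div_le_iff₀ hN]; nlinarith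
  have hsin0 : 0 ≤ Real.sin (Real.pi * τ / N) := Real.sin_nonneg_of_nonneg_of_le_pi hθ0 hθπ
  rw [abs_of_nonneg hsin0]
  rcases le_total τ (N - τ) with hle | hle
  · rw [min_eq_left hle]
    have hθ2 : Real.pi * τ / N ≤ Real.pi / 2 := by rw [div_le_iff₀ hN]; nlinarith
    constructor
    · -- Jordan: `(2∕π)θ ≤ sin θ` on `[0, π∕2]`
      have hj := Real.mul_le_sin hθ0 hθ2
      calc 2 / Real.pi * τ = N / Real.pi * (2 / Real.pi * (Real.pi * τ / N)) := by field_simp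
        _ ≤ N / Real.pi * Real.sin (Real.pi * τ / N) := mul_le_mul_of_nonneg_left hj hNπ.le
    · have hs := Real.sin_le hθ0
      calc N / Real.pi * Real.sin (Real.pi * τ / N) ≤ N / Real.pi * (Real.pi * τ / N) := mul_le_mul_of_nonneg_left hs hNπ.le
        _ = τ := by field_simp
  · rw [min_eq_right hle]
    -- reflect: `sin θ = sin (π − θ)`, `π − θ = π(N−τ)∕N ∈ [0, π∕2]`
    have er : Real.sin (Real.pi * τ / N) = Real.sin (Real.pi * (N - τ) / N) := by
      rw [← Real.sin_pi_sub]; congr 1; field_simp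
    rw [er]
    have hφ0 : 0 ≤ Real.pi * (N - τ) / N := by apply div_nonneg _ hN.le; nlinarith
    have hφ2 : Real.pi * (N - τ) / N ≤ Real.pi / 2 := by rw [div_le_iff₀ hN]; nlinarith
    constructor
    · have hj := Real.mul_le_sin hφ0 hφ2
      calc 2 / Real.pi * (N - τ) = N / Real.pi * (2 / Real.pi * (Real.pi * (N - τ) / N)) := by field_simp
        _ ≤ N / Real.pi * Real.sin (Real.pi * (N - τ) / N) := mul_le_mul_of_nonneg_left hj hNπ.le
    · have hs := Real.sin_le hφ0
      calc N / Real.pi * Real.sin (Real.pi * (N - τ) / N) ≤ N / Real.pi * (Real.pi * (N - τ) / N) := mul_le_mul_of_nonneg_left hs hNπ.le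
        _ = N - τ := by field_simp


end Summit.QuantumFields.YangMills.Theorems.Prop7TorusAgmonWeight

end
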